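import Literature.MathematicalPhysics.QuantumFieldTheory.Balaban1983to89.T4ContinuumYM4Torus
import Summits.QuantumFields.BalabanUV.Gaps.CapTailPinnedLimitSign
import Summits.QuantumFields.BalabanUV.Gaps.CapTailEndNecessity

/-!
# `BalabanUV.Gaps.D1PinnedLimitClosedForm` — cell pub-balaban-gaps, row (D1), seat g1-p1: AT THE β-LEAD's PINNED LITERAL `JsBalAn1` THE LIMIT OF THE
# ONE-LOOP STEP COEFFICIENTS IS, HYPOTHESIS-FREE, ONE CLOSED-FORM NUMBER — the `(μ,ν)` second moment `M∞` of the axially dressed Hessian kernel at the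
# CONSTRUCTED limit primitives `(K∞, S∞, W∞)` of gan24-p1's closing sentence — so the row's two pinned currencies COINCIDE (`CauchyRate.lim β⁰ = M∞`), and
# the END's β⁰-side input at the literal is the SIGN of `M∞`

HONEST FRAMING (cell rule, page 1 of everything): bookkeeping BY NAME over tree theorems — gan24-p1's hypothesis-free rows for the pinned literal
(`GAN24.WSlotT2TablesAn1.hW_hWall_three_an1At_pinned`, `GAN24.StencilSlotSAllThree.hS_hSall_three`, `GAN24.KSlotAssembly.convCKWall_holds`, merged by asym1's
`HessKerConvCKPlug.exists_merged_rows`), asym1's unit-covariant LIMIT-currency socket `HessKerDressedUnitsWall.geomRate_secondMoment_TbalOf_JsBalOf_lim_unit` at the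
CONSTRUCTED limits (`HessKerDressedLimit.decays_limMKerOf` ∕ `locStencil_limStOf` ∕ `vertexFamily₂_limTabOf` and their rate twins), Mathlib's uniqueness of limits
(`Filter.Tendsto.limUnder_eq`), and g1-p3's pinned files `Gaps/CapTailPinnedLimitSign` ∕ `Gaps/CapTailEndNecessity`.  NOTHING of Bałaban's is asserted beyond print;
[Balaban1987RG1] Thm 2 is UNPROVED IN PRINT; the VALUE of `M∞` is NOT computed here (that computation — `M∞ = (11N²∕12π²)·log Lc` for Bałaban's colour data — IS
the wall (D1) at this literal, the β sub-cell's identification `hident` ∕ road A2's «second half») and its SIGN is NOT decided here; the family `JsBalAn1 …` does NOT depend on the numeral `N` and its colour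
data `cE cVH cΛ cB Tc` are free reals ∕ a free table ((P6), pinned last); 0 coefficients certified; (D1) NOT discharged at any literal; 0∕4 row-D1 binders; NOT
`BetaPertH`, NOT the continuum limit, NOT Clay.  HONEST DEPENDENCY (b2b cell, verbatim): «continuum YM on T⁴ ⇐ BetaPertH ∧ nine spine estimates (0/9 proved);
BetaPertH ⇐ (D1) ∧ (D4) ∧ CAP+tail; G-an2-4 gates asym, D1 and NE2/3/4.»

WHY (row (D1) of `HOME/BALABAN-GAPS.md`; RESIDUE (D1) rows 55 ∕ 58).  Two pinned currencies of the SAME residual live in the tree without a typed bridge: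
(a) the SCALAR currency `CauchyRate.lim (j ↦ β⁰_j)` (`= limUnder atTop`) of g1-p3's `CapTailPinnedLimitSign` (END grade ⟸ `0 < lim`), `CapTailEndNecessity`
(END ⟹ `0 ≤ lim`) and this lineage's `D1PinnedNumeral` (`N_eff = √(12π²·lim ∕ (11·log Lc))`), `D1ValueSocketsPinned`; (b) gan24-p1's LIMIT-KERNEL currency
`GAN24.WSlotT2TablesAn1.d1Drift_iff_three_JsBalAn1_pinned`: (D1) ⟺ `M∞ = stepBal N Lc` with
`M∞ := secondMoment (hessKer (axDressK Lc K∞) (axVertexOfK K∞ Lc S∞) W∞) μ ν`, `K∞ = limMKerOf (j ↦ unitK (sfStep Lc j) (smStep 3 Lc j) (KInvStep Lc j))`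
(road FP's perfect one-step resolvent `KPerf … 1`, gan24-p3 `GAN24.PerfectStepFibre`), `S∞ = limStOf (j ↦ unitS … (JsBal⁰_j).S)`, `W∞ = limTabOf (j ↦ unitW … (WbalOf … j))`.
From the two equivalences alone `lim = M∞` follows only when `0 ≤ lim` (take `N := N_eff`); the identity itself needs the RATE TO THE CLOSED FORM, which sits
inside the proof of asym1's socket `HessKerDressedUnitsWall.d1Drift_JsBalOf_iff_of_lim_unit` and is exported here at the pin.  CONSEQUENCE FOR THE ROW: every
pinned statement in `lim` currency reads on ONE closed-form limit-kernel second moment `M∞`, whose evaluation IS the wall at THIS literal (road A2's «second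
half» ∕ the β sub-cell's `hident` binder of `AveragedAFCarrierJsBalAn1.wallEND_of_cauchy_eq_JsBalAn1_cont_allProfiles`, there in RAW units under the six
(CONV-C-Cauchy) binders; here in gan24's RESCALED units, hypothesis-free) — distinct from road BF-x's one-shot pricing at an2's (III′) comb literal
(`OneShotLaw`, `Gaps/D1RoadsJunctionPinned` ∕ `Gaps/D1ValueSockets` §3), which this file does not touch.

CONTENT (all [folklore]; no `def`, no `def … : Prop`, nothing cited as a hypothesis, 0 sorry; `2 ≤ Lc`, root `r ∈ box 4 Lc`, any colour data, any channel):
* §1 **`exists_geomRate_closedForm_pinned`** — `∃ c₀ θ, 0 ≤ θ < 1 ∧ GeomRate (j ↦ β⁰_j) M∞ c₀ θ` (hypothesis-free geometric rate TO THE CLOSED FORM);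
  **`tendsto_closedForm_pinned`** — `β⁰_j → M∞`; **`lim_eq_closedForm_pinned`** — `CauchyRate.lim (j ↦ β⁰_j) = M∞` (THE BRIDGE).
* §2 END grade at the literal on `M∞`: **`endpointExistence_of_closedForm_pos`** (`0 < M∞` + the dictionary `hβ` + `EverySlope` + (U)∕(L)∕(C) + forward generation ⟹
  `EndpointExistence C`; g1-p3's `endpointExistence_of_pinned_limPos` across the bridge) and **`closedForm_nonneg_of_endpointExistence`** (END ⟹ `0 ≤ M∞`; g1-p3's
  `CapTailEndNecessity.limNonneg_of_endpointExistence_pinned` across the bridge): up to the boundary `M∞ = 0`, the END-grade content of the β⁰-side at the pinned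
  literal is the SIGN of the one number `M∞`; and THE T⁴ HEADLINE FROM THE SIGN OF THAT ONE NUMBER: **`continuumYM4Torus_of_closedForm_pos`** — a
  printed-averaged finite-ε datum `D` on `SU(n)` ((B1)), (B) ((B2)), the dictionary `hβ` (the datum's one-loop coefficients ARE the pinned literal's),
  `0 < M∞`, `EverySlope` ((D4) currency), (U)∕(L)∕(C) on the boxes, and the spine slot `HybridNE7Under D (EndpointExistence D.C.toB12)` ⟹
  `ContinuumYM4Torus D ∧ ContinuumYM4TorusE D` (the print-faithful headline `T4ContinuumYM4Torus.continuumYM4_torus_of_endpointExistence_nonvacuous`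
  with `hEnd :=` §2; forward generation is the field `D.fwd`).  Every binder a hypothesis; the β-binder of the headline at this literal is ONE strict sign.
* §3 the bridge at the CENTRED root — road BF-x's literal `JsBalAn1Ctr` (`= JsBalAn1 … (ctrOff_mem_box …)` by `rfl`): **`tendsto_closedForm_pinnedCtr`**,
  **`lim_eq_closedForm_pinnedCtr`**.
The numeral statements of `Gaps/D1PinnedNumeral` re-read on `M∞` (`(∃ N, D1Drift …) ↔ 0 ≤ M∞`, `N_eff` in closed form, uniqueness, `(∃ N > 0, …) ↔ 0 < M∞`)
follow by `rw [← lim_eq_closedForm_pinned]` and are typed in the sibling `Gaps/D1PinnedNumeralClosedForm` (separate file: import hygiene).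
READING (zero classification weight): nothing about (D1)'s difficulty moves — the wall at the pinned literal was and is the evaluation of ONE number; this file
certifies that the number the END reads (`lim β⁰`, through its sign) and the number gan24-p1's identification names (`M∞`, through its value) are the same real,
hypothesis-free.

ABSOLUTE RULE (cell charter, verbatim): «No internally-minted statement may enter as a cited fact. Every hypothesis is either kernel-proved in this
package or a verbatim quotation of a PUBLISHED theorem with page reference. The manuscript(s) under audit are NOT citable for their own disputed
steps — they are the thing under adjudication; programme-internal (2001/route/tribunal) claims are never citable.»

Provenance: cell pub-balaban-gaps, seat g1-p1 GEN 9 (prover-pub-balaban-gaps-g1-p1-g9-0), 2026-08-23; imports the Literature headline module `T4ContinuumYM4Torus` and g1-p3's `Gaps/CapTailPinnedLimitSign` ∕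
`Gaps/CapTailEndNecessity` ONLY (transitively gan24-p1's `GAN24.WSlotT2TablesAn1`, asym1's `HessKerDressedUnitsWall` ∕ `HessKerConvCKPlug` ∕ `HessKerDressedLimit`);
every tree theorem used BY NAME; no existing file touched.
-/

noncomputable section

open Finset Filter Topology
open scoped BigOperators
open Literature.MathematicalPhysics.QuantumFieldTheory
open Literature.MathematicalPhysics.QuantumFieldTheory.Balaban1983to89
open Literature.MathematicalPhysics.QuantumFieldTheory.Balaban1983to89.FlowStep
open Literature.MathematicalPhysics.QuantumFieldTheory.Balaban1983to89.FlowStepRuns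
open Literature.MathematicalPhysics.QuantumFieldTheory.Balaban1983to89.DagBinding
open Literature.MathematicalPhysics.QuantumFieldTheory.Balaban1983to89.Beta
open AffineAveraging (box toSite)
open AveragingContoursRooted (ctrOff ctrOff_mem_box)
open ExpKernelCalculus (MKer VertexFamily₂ hessKer)
open OneStepResolventKernel (Fib LocStencil)
open OneStepKernelFamily (KInvStep D1Drift TbalOf)
open RemainderConstAllScales (AllScalesSeq)
open RateCertificate (GeomRate CauchyRate)
open AxialDressing (axDressK axVertexOfK)
open BalabanStepJetsSucc (JsBal0Of JsBalOf)
open BalabanStepW2 (T2Of T2Of_loc CwOf δwOf δwOf_pos WbalOf_loc₂ WbalOf)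
open AveragingMixedJetTables (vh₂SAt mixFFAt)
open HessKerDressedLimit (limMKerOf limStOf limTabOf decays_limMKerOf decays_sub_limMKerOf locStencil_limStOf locStencil_sub_limStOf
  vertexFamily₂_limTabOf vertexFamily₂_sub_limTabOf)
open Summit.QuantumFields.BalabanUV.Beta.HessKerDressedUnits (unitK unitS unitW)
open Summit.QuantumFields.BalabanUV.Beta.MixedJetTablesPlug (hmix_an1 hB_an1 JsBalAn1 JsBalAn1Ctr)
open Summit.QuantumFields.BalabanUV.Beta.GAN24.CombesThomas (sfStep smStep sfStep_ne_zero smStep_ne_zero)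
open Summit.QuantumFields.BalabanUV.Beta.GAN24.StencilSlotOfE3 (one_le_of_two_le)
open Summit.QuantumFields.BalabanUV.Beta.GAN24.KSlotAssembly (convCKWall_holds)
open Summit.QuantumFields.BalabanUV.Beta.GAN24.StencilSlotSAllThree (hS_hSall_three)
open Summit.QuantumFields.BalabanUV.Beta.HessKerConvCKPlug (exists_merged_rows)
open Summit.QuantumFields.BalabanUV.Beta.HessKerDressedUnitsWall (geomRate_secondMoment_TbalOf_JsBalOf_lim_unit)
open Summit.QuantumFields.BalabanUV.Beta.GAN24.WSlotT2TablesAn1 (hW_hWall_three_an1At_pinned)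
open Summit.QuantumFields.BalabanUV.Gaps.CapSignsConstRoad (EverySlope)
open Summit.QuantumFields.BalabanUV.Gaps.CapTailPinnedLimitSign (endpointExistence_of_pinned_limPos)
open Summit.QuantumFields.BalabanUV.Gaps.CapTailEndNecessity (limNonneg_of_endpointExistence_pinned)
open Literature.MathematicalPhysics.QuantumFieldTheory.Balaban1983to89.T4Continuum
open Literature.MathematicalPhysics.QuantumFieldTheory.Balaban1983to89.T4ContinuumYM4Torus

namespace Summit.QuantumFields.BalabanUV.Gaps.D1PinnedLimitClosedForm

variable {Lc : ℕ} [NeZero Lc] {r : Fin (3 + 1) → ℕ}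

/-! ## §1 The hypothesis-free rate TO THE CLOSED FORM, convergence, and the bridge `lim β⁰ = M∞` -/

/-- [folklore] **A GEOMETRIC RATE OF THE PINNED LITERAL's ONE-LOOP STEP COEFFICIENTS TO THE CLOSED-FORM LIMIT `M∞`, HYPOTHESIS-FREE**:
`∃ c₀ θ, 0 ≤ θ < 1 ∧ GeomRate (j ↦ secondMoment (TbalOf Lc (JsBalAn1 …) j) μ ν) M∞ c₀ θ`, `M∞` the `(μ,ν)` second moment of
`hessKer (axDressK Lc K∞) (axVertexOfK K∞ Lc S∞) W∞` at the CONSTRUCTED limits of the unit-rescaled primitives (gan24-p1's closing-sentence object).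
Assembly = gan24-p1's `allScalesSeq_secondMoment_JsBalAn1_pinned` verbatim (W-pair, S-rows, K-rows, merge) with asym1's LIMIT-currency socket
`geomRate_secondMoment_TbalOf_JsBalOf_lim_unit` at the constructed limits in place of the scalar one; the constant `c₀` is explicit inside the `∃`, not a number. -/
theorem exists_geomRate_closedForm_pinned (hLc : 2 ≤ Lc) (hr : r ∈ box (3 + 1) Lc) (cE cVH cΛ cB : ℝ)
    (Tc : Fin 4 → Fin 4 → Fin 4 → Fin 4 → ℝ) (μ ν : Fin 4) :
    ∃ c₀ θ : ℝ, 0 ≤ θ ∧ θ < 1 ∧ GeomRate (fun j => B12Beta.secondMoment (TbalOf Lc (JsBalAn1 (one_le_of_two_le hLc) hr cE cVH cΛ ((Lc : ℝ) ^ (2 * (3 + 1))) cB Tc) j) μ ν)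
      (B12Beta.secondMoment (hessKer (axDressK Lc (limMKerOf fun j => unitK (sfStep Lc j) (smStep 3 Lc j) (KInvStep (d := 3) Lc j)))
        (axVertexOfK (limMKerOf fun j => unitK (sfStep Lc j) (smStep 3 Lc j) (KInvStep (d := 3) Lc j)) Lc
          (limStOf fun j => unitS (sfStep Lc j) (smStep 3 Lc j) (JsBal0Of (one_le_of_two_le hLc) cE cVH cΛ (WbalOf 3 Lc cE cVH cΛ (T2Of 3 Lc cE cVH cΛ ((Lc : ℝ) ^ (2 * (3 + 1))) cB Tc (vh₂SAt (toSite r) Lc) (mixFFAt (toSite r) Lc)) (mixFFAt (toSite r) Lc))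
            (CwOf (one_le_of_two_le hLc) cE cVH cΛ (T2Of_loc (one_le_of_two_le hLc) cE cVH cΛ ((Lc : ℝ) ^ (2 * (3 + 1))) cB Tc (hB_an1 (one_le_of_two_le hLc) hr) (hmix_an1 (one_le_of_two_le hLc) hr)) (hmix_an1 (one_le_of_two_le hLc) hr)) (δwOf (one_le_of_two_le hLc) cE cVH cΛ (T2Of_loc (one_le_of_two_le hLc) cE cVH cΛ ((Lc : ℝ) ^ (2 * (3 + 1))) cB Tc (hB_an1 (one_le_of_two_le hLc) hr) (hmix_an1 (one_le_of_two_le hLc) hr)) (hmix_an1 (one_le_of_two_le hLc) hr))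
            (δwOf_pos (one_le_of_two_le hLc) cE cVH cΛ (T2Of_loc (one_le_of_two_le hLc) cE cVH cΛ ((Lc : ℝ) ^ (2 * (3 + 1))) cB Tc (hB_an1 (one_le_of_two_le hLc) hr) (hmix_an1 (one_le_of_two_le hLc) hr)) (hmix_an1 (one_le_of_two_le hLc) hr)) (WbalOf_loc₂ (one_le_of_two_le hLc) cE cVH cΛ (T2Of_loc (one_le_of_two_le hLc) cE cVH cΛ ((Lc : ℝ) ^ (2 * (3 + 1))) cB Tc (hB_an1 (one_le_of_two_le hLc) hr) (hmix_an1 (one_le_of_two_le hLc) hr)) (hmix_an1 (one_le_of_two_le hLc) hr)) j).S))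
        (limTabOf fun j => unitW (sfStep Lc j) (smStep 3 Lc j) (WbalOf 3 Lc cE cVH cΛ (T2Of 3 Lc cE cVH cΛ ((Lc : ℝ) ^ (2 * (3 + 1))) cB Tc (vh₂SAt (toSite r) Lc) (mixFFAt (toSite r) Lc)) (mixFFAt (toSite r) Lc) j))) μ ν) c₀ θ := by
  obtain ⟨Cw, cW, θW, δW, hθW0, hθW1, hδW, hW₂, hW₂all⟩ := hW_hWall_three_an1At_pinned hLc hr cE cVH cΛ cB Tc
  obtain ⟨Cs, cS, θS, δS, hθS0, hθS1, hδS, hS, hSall⟩ := hS_hSall_three hLc cE cVH cΛ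
    (WbalOf 3 Lc cE cVH cΛ (T2Of 3 Lc cE cVH cΛ ((Lc : ℝ) ^ (2 * (3 + 1))) cB Tc (vh₂SAt (toSite r) Lc) (mixFFAt (toSite r) Lc)) (mixFFAt (toSite r) Lc)) _ _
    (δwOf_pos (one_le_of_two_le hLc) cE cVH cΛ (T2Of_loc (one_le_of_two_le hLc) cE cVH cΛ ((Lc : ℝ) ^ (2 * (3 + 1))) cB Tc (hB_an1 (one_le_of_two_le hLc) hr) (hmix_an1 (one_le_of_two_le hLc) hr)) (hmix_an1 (one_le_of_two_le hLc) hr))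
    (WbalOf_loc₂ (one_le_of_two_le hLc) cE cVH cΛ (T2Of_loc (one_le_of_two_le hLc) cE cVH cΛ ((Lc : ℝ) ^ (2 * (3 + 1))) cB Tc (hB_an1 (one_le_of_two_le hLc) hr) (hmix_an1 (one_le_of_two_le hLc) hr)) (hmix_an1 (one_le_of_two_le hLc) hr))
  obtain ⟨C, δK, cK, θ, R, hR, hRK, hRS, hRW, hθ0, hθ1, hK, hKall, hSall', hWall'⟩ :=
    exists_merged_rows (Lc := Lc) (convCKWall_holds (Lc := Lc) hLc)
      (S := fun j => unitS (sfStep Lc j) (smStep 3 Lc j) (JsBal0Of (one_le_of_two_le hLc) cE cVH cΛ (WbalOf 3 Lc cE cVH cΛ (T2Of 3 Lc cE cVH cΛ ((Lc : ℝ) ^ (2 * (3 + 1))) cB Tc (vh₂SAt (toSite r) Lc) (mixFFAt (toSite r) Lc)) (mixFFAt (toSite r) Lc))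
        (CwOf (one_le_of_two_le hLc) cE cVH cΛ (T2Of_loc (one_le_of_two_le hLc) cE cVH cΛ ((Lc : ℝ) ^ (2 * (3 + 1))) cB Tc (hB_an1 (one_le_of_two_le hLc) hr) (hmix_an1 (one_le_of_two_le hLc) hr)) (hmix_an1 (one_le_of_two_le hLc) hr)) (δwOf (one_le_of_two_le hLc) cE cVH cΛ (T2Of_loc (one_le_of_two_le hLc) cE cVH cΛ ((Lc : ℝ) ^ (2 * (3 + 1))) cB Tc (hB_an1 (one_le_of_two_le hLc) hr) (hmix_an1 (one_le_of_two_le hLc) hr)) (hmix_an1 (one_le_of_two_le hLc) hr))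
        (δwOf_pos (one_le_of_two_le hLc) cE cVH cΛ (T2Of_loc (one_le_of_two_le hLc) cE cVH cΛ ((Lc : ℝ) ^ (2 * (3 + 1))) cB Tc (hB_an1 (one_le_of_two_le hLc) hr) (hmix_an1 (one_le_of_two_le hLc) hr)) (hmix_an1 (one_le_of_two_le hLc) hr)) (WbalOf_loc₂ (one_le_of_two_le hLc) cE cVH cΛ (T2Of_loc (one_le_of_two_le hLc) cE cVH cΛ ((Lc : ℝ) ^ (2 * (3 + 1))) cB Tc (hB_an1 (one_le_of_two_le hLc) hr) (hmix_an1 (one_le_of_two_le hLc) hr)) (hmix_an1 (one_le_of_two_le hLc) hr)) j).S)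
      (W := fun j => unitW (sfStep Lc j) (smStep 3 Lc j) (WbalOf 3 Lc cE cVH cΛ (T2Of 3 Lc cE cVH cΛ ((Lc : ℝ) ^ (2 * (3 + 1))) cB Tc (vh₂SAt (toSite r) Lc) (mixFFAt (toSite r) Lc)) (mixFFAt (toSite r) Lc) j))
      hSall hW₂all hδS hδW hθS0 hθS1 hθW0 hθW1
  exact ⟨_, θ, hθ0, hθ1, geomRate_secondMoment_TbalOf_JsBalOf_lim_unit (one_le_of_two_le hLc) cE cVH cΛ _ _ _ _ _ (sfStep Lc) (smStep 3 Lc)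
    (Kinf := limMKerOf fun j => unitK (sfStep Lc j) (smStep 3 Lc j) (KInvStep (d := 3) Lc j))
    (Sinf := limStOf fun j => unitS (sfStep Lc j) (smStep 3 Lc j) (JsBal0Of (one_le_of_two_le hLc) cE cVH cΛ (WbalOf 3 Lc cE cVH cΛ (T2Of 3 Lc cE cVH cΛ ((Lc : ℝ) ^ (2 * (3 + 1))) cB Tc (vh₂SAt (toSite r) Lc) (mixFFAt (toSite r) Lc)) (mixFFAt (toSite r) Lc))
      (CwOf (one_le_of_two_le hLc) cE cVH cΛ (T2Of_loc (one_le_of_two_le hLc) cE cVH cΛ ((Lc : ℝ) ^ (2 * (3 + 1))) cB Tc (hB_an1 (one_le_of_two_le hLc) hr) (hmix_an1 (one_le_of_two_le hLc) hr)) (hmix_an1 (one_le_of_two_le hLc) hr)) (δwOf (one_le_of_two_le hLc) cE cVH cΛ (T2Of_loc (one_le_of_two_le hLc) cE cVH cΛ ((Lc : ℝ) ^ (2 * (3 + 1))) cB Tc (hB_an1 (one_le_of_two_le hLc) hr) (hmix_an1 (one_le_of_two_le hLc) hr)) (hmix_an1 (one_le_of_two_le hLc) hr))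
      (δwOf_pos (one_le_of_two_le hLc) cE cVH cΛ (T2Of_loc (one_le_of_two_le hLc) cE cVH cΛ ((Lc : ℝ) ^ (2 * (3 + 1))) cB Tc (hB_an1 (one_le_of_two_le hLc) hr) (hmix_an1 (one_le_of_two_le hLc) hr)) (hmix_an1 (one_le_of_two_le hLc) hr)) (WbalOf_loc₂ (one_le_of_two_le hLc) cE cVH cΛ (T2Of_loc (one_le_of_two_le hLc) cE cVH cΛ ((Lc : ℝ) ^ (2 * (3 + 1))) cB Tc (hB_an1 (one_le_of_two_le hLc) hr) (hmix_an1 (one_le_of_two_le hLc) hr)) (hmix_an1 (one_le_of_two_le hLc) hr)) j).S)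
    (Winf := limTabOf fun j => unitW (sfStep Lc j) (smStep 3 Lc j) (WbalOf 3 Lc cE cVH cΛ (T2Of 3 Lc cE cVH cΛ ((Lc : ℝ) ^ (2 * (3 + 1))) cB Tc (vh₂SAt (toSite r) Lc) (mixFFAt (toSite r) Lc)) (mixFFAt (toSite r) Lc) j))
    sfStep_ne_zero smStep_ne_zero hK (decays_limMKerOf hK hKall hθ1) (decays_sub_limMKerOf hKall hθ1) hS (locStencil_limStOf hS hSall' hθ1)
    (locStencil_sub_limStOf hSall' hθ1) hW₂ (vertexFamily₂_limTabOf hW₂ hWall' hθ1) (vertexFamily₂_sub_limTabOf hWall' hθ1) hR (by linarith) hRS hRW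
    μ ν⟩

/-- [folklore] **CONVERGENCE TO THE CLOSED FORM**: `secondMoment (TbalOf Lc (JsBalAn1 …) j) μ ν → M∞` as `j → ∞`, hypothesis-free (`GeomRate.tendsto`). -/
theorem tendsto_closedForm_pinned (hLc : 2 ≤ Lc) (hr : r ∈ box (3 + 1) Lc) (cE cVH cΛ cB : ℝ)
    (Tc : Fin 4 → Fin 4 → Fin 4 → Fin 4 → ℝ) (μ ν : Fin 4) :
    Tendsto (fun j => B12Beta.secondMoment (TbalOf Lc (JsBalAn1 (one_le_of_two_le hLc) hr cE cVH cΛ ((Lc : ℝ) ^ (2 * (3 + 1))) cB Tc) j) μ ν) atTop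
      (𝓝 (B12Beta.secondMoment (hessKer (axDressK Lc (limMKerOf fun j => unitK (sfStep Lc j) (smStep 3 Lc j) (KInvStep (d := 3) Lc j)))
        (axVertexOfK (limMKerOf fun j => unitK (sfStep Lc j) (smStep 3 Lc j) (KInvStep (d := 3) Lc j)) Lc
          (limStOf fun j => unitS (sfStep Lc j) (smStep 3 Lc j) (JsBal0Of (one_le_of_two_le hLc) cE cVH cΛ (WbalOf 3 Lc cE cVH cΛ (T2Of 3 Lc cE cVH cΛ ((Lc : ℝ) ^ (2 * (3 + 1))) cB Tc (vh₂SAt (toSite r) Lc) (mixFFAt (toSite r) Lc)) (mixFFAt (toSite r) Lc))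
            (CwOf (one_le_of_two_le hLc) cE cVH cΛ (T2Of_loc (one_le_of_two_le hLc) cE cVH cΛ ((Lc : ℝ) ^ (2 * (3 + 1))) cB Tc (hB_an1 (one_le_of_two_le hLc) hr) (hmix_an1 (one_le_of_two_le hLc) hr)) (hmix_an1 (one_le_of_two_le hLc) hr)) (δwOf (one_le_of_two_le hLc) cE cVH cΛ (T2Of_loc (one_le_of_two_le hLc) cE cVH cΛ ((Lc : ℝ) ^ (2 * (3 + 1))) cB Tc (hB_an1 (one_le_of_two_le hLc) hr) (hmix_an1 (one_le_of_two_le hLc) hr)) (hmix_an1 (one_le_of_two_le hLc) hr))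
            (δwOf_pos (one_le_of_two_le hLc) cE cVH cΛ (T2Of_loc (one_le_of_two_le hLc) cE cVH cΛ ((Lc : ℝ) ^ (2 * (3 + 1))) cB Tc (hB_an1 (one_le_of_two_le hLc) hr) (hmix_an1 (one_le_of_two_le hLc) hr)) (hmix_an1 (one_le_of_two_le hLc) hr)) (WbalOf_loc₂ (one_le_of_two_le hLc) cE cVH cΛ (T2Of_loc (one_le_of_two_le hLc) cE cVH cΛ ((Lc : ℝ) ^ (2 * (3 + 1))) cB Tc (hB_an1 (one_le_of_two_le hLc) hr) (hmix_an1 (one_le_of_two_le hLc) hr)) (hmix_an1 (one_le_of_two_le hLc) hr)) j).S))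
        (limTabOf fun j => unitW (sfStep Lc j) (smStep 3 Lc j) (WbalOf 3 Lc cE cVH cΛ (T2Of 3 Lc cE cVH cΛ ((Lc : ℝ) ^ (2 * (3 + 1))) cB Tc (vh₂SAt (toSite r) Lc) (mixFFAt (toSite r) Lc)) (mixFFAt (toSite r) Lc) j))) μ ν)) := by
  obtain ⟨c₀, θ, hθ0, hθ1, hG⟩ := exists_geomRate_closedForm_pinned hLc hr cE cVH cΛ cB Tc μ ν
  exact hG.tendsto hθ0 hθ1

/-- [folklore] **THE BRIDGE — THE TWO PINNED CURRENCIES ARE ONE NUMBER**: `CauchyRate.lim (j ↦ secondMoment (TbalOf Lc (JsBalAn1 …) j) μ ν) = M∞`,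
hypothesis-free (`CauchyRate.lim = limUnder atTop`; Mathlib's `Tendsto.limUnder_eq`).  Every `lim`-currency statement of `CapTailPinnedLimitSign` ∕
`CapTailEndNecessity` ∕ `D1PinnedNumeral` ∕ `D1ValueSocketsPinned` thereby reads on gan24-p1's limit-kernel second moment, and conversely. -/
theorem lim_eq_closedForm_pinned (hLc : 2 ≤ Lc) (hr : r ∈ box (3 + 1) Lc) (cE cVH cΛ cB : ℝ)
    (Tc : Fin 4 → Fin 4 → Fin 4 → Fin 4 → ℝ) (μ ν : Fin 4) :
    CauchyRate.lim (fun j => B12Beta.secondMoment (TbalOf Lc (JsBalAn1 (one_le_of_two_le hLc) hr cE cVH cΛ ((Lc : ℝ) ^ (2 * (3 + 1))) cB Tc) j) μ ν) =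
      B12Beta.secondMoment (hessKer (axDressK Lc (limMKerOf fun j => unitK (sfStep Lc j) (smStep 3 Lc j) (KInvStep (d := 3) Lc j)))
        (axVertexOfK (limMKerOf fun j => unitK (sfStep Lc j) (smStep 3 Lc j) (KInvStep (d := 3) Lc j)) Lc
          (limStOf fun j => unitS (sfStep Lc j) (smStep 3 Lc j) (JsBal0Of (one_le_of_two_le hLc) cE cVH cΛ (WbalOf 3 Lc cE cVH cΛ (T2Of 3 Lc cE cVH cΛ ((Lc : ℝ) ^ (2 * (3 + 1))) cB Tc (vh₂SAt (toSite r) Lc) (mixFFAt (toSite r) Lc)) (mixFFAt (toSite r) Lc))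
            (CwOf (one_le_of_two_le hLc) cE cVH cΛ (T2Of_loc (one_le_of_two_le hLc) cE cVH cΛ ((Lc : ℝ) ^ (2 * (3 + 1))) cB Tc (hB_an1 (one_le_of_two_le hLc) hr) (hmix_an1 (one_le_of_two_le hLc) hr)) (hmix_an1 (one_le_of_two_le hLc) hr)) (δwOf (one_le_of_two_le hLc) cE cVH cΛ (T2Of_loc (one_le_of_two_le hLc) cE cVH cΛ ((Lc : ℝ) ^ (2 * (3 + 1))) cB Tc (hB_an1 (one_le_of_two_le hLc) hr) (hmix_an1 (one_le_of_two_le hLc) hr)) (hmix_an1 (one_le_of_two_le hLc) hr))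
            (δwOf_pos (one_le_of_two_le hLc) cE cVH cΛ (T2Of_loc (one_le_of_two_le hLc) cE cVH cΛ ((Lc : ℝ) ^ (2 * (3 + 1))) cB Tc (hB_an1 (one_le_of_two_le hLc) hr) (hmix_an1 (one_le_of_two_le hLc) hr)) (hmix_an1 (one_le_of_two_le hLc) hr)) (WbalOf_loc₂ (one_le_of_two_le hLc) cE cVH cΛ (T2Of_loc (one_le_of_two_le hLc) cE cVH cΛ ((Lc : ℝ) ^ (2 * (3 + 1))) cB Tc (hB_an1 (one_le_of_two_le hLc) hr) (hmix_an1 (one_le_of_two_le hLc) hr)) (hmix_an1 (one_le_of_two_le hLc) hr)) j).S))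
        (limTabOf fun j => unitW (sfStep Lc j) (smStep 3 Lc j) (WbalOf 3 Lc cE cVH cΛ (T2Of 3 Lc cE cVH cΛ ((Lc : ℝ) ^ (2 * (3 + 1))) cB Tc (vh₂SAt (toSite r) Lc) (mixFFAt (toSite r) Lc)) (mixFFAt (toSite r) Lc) j))) μ ν :=
  (tendsto_closedForm_pinned hLc hr cE cVH cΛ cB Tc μ ν).limUnder_eq

/-! ## §2 END grade at the pinned literal on `M∞`: sufficiency of `0 < M∞`, necessity of `0 ≤ M∞` -/

section EndGrade

variable {β : HBeta}

/-- [folklore] **END GRADE AT THE PINNED LITERAL FROM `0 < M∞`**: a construction forward-generated by `β` whose split `S` carries the literal's one-loop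
coefficients (`hβ`, the reading clause as a binder), `0 < M∞`, `EverySlope S γc` ((D4) currency), (U), (L) on the boxes, (C) ⟹ `EndpointExistence C` — g1-p3's
`CapTailPinnedLimitSign.endpointExistence_of_pinned_limPos` with its `hlim` read across the bridge.  NO identification `M∞ = stepBal N Lc`, NO numeral, NO early sign.
[cite: Balaban1987RG1, Thm 2 p.259 (first sentence) and (1.22) p.264] -/
theorem endpointExistence_of_closedForm_pos (hLc : 2 ≤ Lc) (hr : r ∈ box (3 + 1) Lc) (cE cVH cΛ cB : ℝ)
    (Tc : Fin 4 → Fin 4 → Fin 4 → Fin 4 → ℝ) (μ ν : Fin 4) {C : B12.Construction} (hgen : ForwardGenerated C β)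
    (S : B12Beta.OneLoopSplit β)
    (hβ : ∀ j, S.β0 j = B12Beta.secondMoment (TbalOf Lc (JsBalAn1 (one_le_of_two_le hLc) hr cE cVH cΛ ((Lc : ℝ) ^ (2 * (3 + 1))) cB Tc) j) μ ν)
    (hM : 0 < B12Beta.secondMoment (hessKer (axDressK Lc (limMKerOf fun j => unitK (sfStep Lc j) (smStep 3 Lc j) (KInvStep (d := 3) Lc j)))
      (axVertexOfK (limMKerOf fun j => unitK (sfStep Lc j) (smStep 3 Lc j) (KInvStep (d := 3) Lc j)) Lc
        (limStOf fun j => unitS (sfStep Lc j) (smStep 3 Lc j) (JsBal0Of (one_le_of_two_le hLc) cE cVH cΛ (WbalOf 3 Lc cE cVH cΛ (T2Of 3 Lc cE cVH cΛ ((Lc : ℝ) ^ (2 * (3 + 1))) cB Tc (vh₂SAt (toSite r) Lc) (mixFFAt (toSite r) Lc)) (mixFFAt (toSite r) Lc))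
          (CwOf (one_le_of_two_le hLc) cE cVH cΛ (T2Of_loc (one_le_of_two_le hLc) cE cVH cΛ ((Lc : ℝ) ^ (2 * (3 + 1))) cB Tc (hB_an1 (one_le_of_two_le hLc) hr) (hmix_an1 (one_le_of_two_le hLc) hr)) (hmix_an1 (one_le_of_two_le hLc) hr)) (δwOf (one_le_of_two_le hLc) cE cVH cΛ (T2Of_loc (one_le_of_two_le hLc) cE cVH cΛ ((Lc : ℝ) ^ (2 * (3 + 1))) cB Tc (hB_an1 (one_le_of_two_le hLc) hr) (hmix_an1 (one_le_of_two_le hLc) hr)) (hmix_an1 (one_le_of_two_le hLc) hr))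
          (δwOf_pos (one_le_of_two_le hLc) cE cVH cΛ (T2Of_loc (one_le_of_two_le hLc) cE cVH cΛ ((Lc : ℝ) ^ (2 * (3 + 1))) cB Tc (hB_an1 (one_le_of_two_le hLc) hr) (hmix_an1 (one_le_of_two_le hLc) hr)) (hmix_an1 (one_le_of_two_le hLc) hr)) (WbalOf_loc₂ (one_le_of_two_le hLc) cE cVH cΛ (T2Of_loc (one_le_of_two_le hLc) cE cVH cΛ ((Lc : ℝ) ^ (2 * (3 + 1))) cB Tc (hB_an1 (one_le_of_two_le hLc) hr) (hmix_an1 (one_le_of_two_le hLc) hr)) (hmix_an1 (one_le_of_two_le hLc) hr)) j).S))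
      (limTabOf fun j => unitW (sfStep Lc j) (smStep 3 Lc j) (WbalOf 3 Lc cE cVH cΛ (T2Of 3 Lc cE cVH cΛ ((Lc : ℝ) ^ (2 * (3 + 1))) cB Tc (vh₂SAt (toSite r) Lc) (mixFFAt (toSite r) Lc)) (mixFFAt (toSite r) Lc) j))) μ ν)
    {γc β' : ℝ} (hrem : EverySlope S γc) (hup : BetaUpperH β' γc β) (hlo : ∀ k, ∀ v ∈ Box γc k, -β' ≤ β k v)
    (hcont : BetaContH γc β) : EndpointExistence C :=
  endpointExistence_of_pinned_limPos hLc hr cE cVH cΛ cB Tc μ ν hgen S hβ ((lim_eq_closedForm_pinned hLc hr cE cVH cΛ cB Tc μ ν).symm ▸ hM) hrem hup hlo hcont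

/-- [folklore] **END GRADE AT THE PINNED LITERAL FORCES `0 ≤ M∞`**: forward generation, the dictionary `hβ`, `EverySlope`, (U) and `EndpointExistence C` ⟹
`0 ≤ M∞` — g1-p3's `CapTailEndNecessity.limNonneg_of_endpointExistence_pinned` across the bridge.  With the previous theorem: up to the boundary `M∞ = 0`, the
END-grade content of the β⁰-side at the pinned literal is the SIGN of the closed-form number `M∞`. [cite: Balaban1987RG1, Thm 2 p.259 (first sentence) and (1.22) p.264] -/
theorem closedForm_nonneg_of_endpointExistence (hLc : 2 ≤ Lc) (hr : r ∈ box (3 + 1) Lc) (cE cVH cΛ cB : ℝ)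
    (Tc : Fin 4 → Fin 4 → Fin 4 → Fin 4 → ℝ) (μ ν : Fin 4) {C : B12.Construction} (hgen : ForwardGenerated C β)
    (S : B12Beta.OneLoopSplit β)
    (hβ : ∀ j, S.β0 j = B12Beta.secondMoment (TbalOf Lc (JsBalAn1 (one_le_of_two_le hLc) hr cE cVH cΛ ((Lc : ℝ) ^ (2 * (3 + 1))) cB Tc) j) μ ν)
    {γc β' : ℝ} (hrem : EverySlope S γc) (hup : BetaUpperH β' γc β) (hE : EndpointExistence C) :
    0 ≤ B12Beta.secondMoment (hessKer (axDressK Lc (limMKerOf fun j => unitK (sfStep Lc j) (smStep 3 Lc j) (KInvStep (d := 3) Lc j)))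
      (axVertexOfK (limMKerOf fun j => unitK (sfStep Lc j) (smStep 3 Lc j) (KInvStep (d := 3) Lc j)) Lc
        (limStOf fun j => unitS (sfStep Lc j) (smStep 3 Lc j) (JsBal0Of (one_le_of_two_le hLc) cE cVH cΛ (WbalOf 3 Lc cE cVH cΛ (T2Of 3 Lc cE cVH cΛ ((Lc : ℝ) ^ (2 * (3 + 1))) cB Tc (vh₂SAt (toSite r) Lc) (mixFFAt (toSite r) Lc)) (mixFFAt (toSite r) Lc))
          (CwOf (one_le_of_two_le hLc) cE cVH cΛ (T2Of_loc (one_le_of_two_le hLc) cE cVH cΛ ((Lc : ℝ) ^ (2 * (3 + 1))) cB Tc (hB_an1 (one_le_of_two_le hLc) hr) (hmix_an1 (one_le_of_two_le hLc) hr)) (hmix_an1 (one_le_of_two_le hLc) hr)) (δwOf (one_le_of_two_le hLc) cE cVH cΛ (T2Of_loc (one_le_of_two_le hLc) cE cVH cΛ ((Lc : ℝ) ^ (2 * (3 + 1))) cB Tc (hB_an1 (one_le_of_two_le hLc) hr) (hmix_an1 (one_le_of_two_le hLc) hr)) (hmix_an1 (one_le_of_two_le hLc) hr))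
          (δwOf_pos (one_le_of_two_le hLc) cE cVH cΛ (T2Of_loc (one_le_of_two_le hLc) cE cVH cΛ ((Lc : ℝ) ^ (2 * (3 + 1))) cB Tc (hB_an1 (one_le_of_two_le hLc) hr) (hmix_an1 (one_le_of_two_le hLc) hr)) (hmix_an1 (one_le_of_two_le hLc) hr)) (WbalOf_loc₂ (one_le_of_two_le hLc) cE cVH cΛ (T2Of_loc (one_le_of_two_le hLc) cE cVH cΛ ((Lc : ℝ) ^ (2 * (3 + 1))) cB Tc (hB_an1 (one_le_of_two_le hLc) hr) (hmix_an1 (one_le_of_two_le hLc) hr)) (hmix_an1 (one_le_of_two_le hLc) hr)) j).S))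
      (limTabOf fun j => unitW (sfStep Lc j) (smStep 3 Lc j) (WbalOf 3 Lc cE cVH cΛ (T2Of 3 Lc cE cVH cΛ ((Lc : ℝ) ^ (2 * (3 + 1))) cB Tc (vh₂SAt (toSite r) Lc) (mixFFAt (toSite r) Lc)) (mixFFAt (toSite r) Lc) j))) μ ν :=
  lim_eq_closedForm_pinned hLc hr cE cVH cΛ cB Tc μ ν ▸ limNonneg_of_endpointExistence_pinned hLc hr cE cVH cΛ cB Tc μ ν hgen S hβ hrem hup hE

end EndGrade

/-! ## §2b THE T⁴ HEADLINE FROM THE SIGN OF ONE CLOSED-FORM NUMBER at the pinned literal (print-faithful headline, `hEnd :=` §2) -/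

section Headline

variable {F : T4Family} {n : ℕ} [NeZero n]

/-- [folklore] **THE T⁴ HEADLINE FROM `0 < M∞` AT THE PINNED LITERAL, NON-VACUOUS** (∀-form ∧ ∃-form): a printed-averaged finite-ε datum `D` on `SU(n)`
((B1) `hD`), Bałaban's (B) as printed ((B2) `hB`), a one-loop split `S` of the datum's OWN β-family `D.βfun` carrying the pinned literal's coefficients (the
dictionary `hβ`), **`0 < M∞`**, `EverySlope S γc` ((D4) currency), (U) `hup`, (L) `hlo`, (C) `hcont` on the boxes `]0,γc]`, and the spine slot
`HybridNE7Under D (EndpointExistence D.C.toB12)` ⟹ `ContinuumYM4Torus D ∧ ContinuumYM4TorusE D` — the Literature headline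
`T4ContinuumYM4Torus.continuumYM4_torus_of_endpointExistence_nonvacuous` with `hEnd := endpointExistence_of_closedForm_pos … D.fwd …`.  AT THIS LITERAL THE
HEADLINE's β-BINDER IS ONE STRICT SIGN of a closed-form limit-kernel second moment (plus the dictionary and the (D4)∕(U)∕(L)∕(C) letters); every binder a
hypothesis; nothing of (D1)'s VALUE `M∞ = (11N²∕12π²)·log Lc` is consumed.  One finite four-torus; NOT ℝ⁴, NOT infinite volume, NOT a mass gap, NOT Clay.
[cite: Balaban1987RG1, Thm 2 p.259] -/
theorem continuumYM4Torus_of_closedForm_pos (hLc : 2 ≤ Lc) (hr : r ∈ box (3 + 1) Lc) (cE cVH cΛ cB : ℝ)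
    (Tc : Fin 4 → Fin 4 → Fin 4 → Fin 4 → ℝ) (μ ν : Fin 4)
    (D : FiniteEpsData F (Matrix.specialUnitaryGroup (Fin n) ℂ)) (hD : D.IsPrintedAveraged) (hB : B16.EndStatementBPrinted D.C)
    (S : B12Beta.OneLoopSplit D.βfun)
    (hβ : ∀ j, S.β0 j = B12Beta.secondMoment (TbalOf Lc (JsBalAn1 (one_le_of_two_le hLc) hr cE cVH cΛ ((Lc : ℝ) ^ (2 * (3 + 1))) cB Tc) j) μ ν)
    (hM : 0 < B12Beta.secondMoment (hessKer (axDressK Lc (limMKerOf fun j => unitK (sfStep Lc j) (smStep 3 Lc j) (KInvStep (d := 3) Lc j)))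
      (axVertexOfK (limMKerOf fun j => unitK (sfStep Lc j) (smStep 3 Lc j) (KInvStep (d := 3) Lc j)) Lc
        (limStOf fun j => unitS (sfStep Lc j) (smStep 3 Lc j) (JsBal0Of (one_le_of_two_le hLc) cE cVH cΛ (WbalOf 3 Lc cE cVH cΛ (T2Of 3 Lc cE cVH cΛ ((Lc : ℝ) ^ (2 * (3 + 1))) cB Tc (vh₂SAt (toSite r) Lc) (mixFFAt (toSite r) Lc)) (mixFFAt (toSite r) Lc))
          (CwOf (one_le_of_two_le hLc) cE cVH cΛ (T2Of_loc (one_le_of_two_le hLc) cE cVH cΛ ((Lc : ℝ) ^ (2 * (3 + 1))) cB Tc (hB_an1 (one_le_of_two_le hLc) hr) (hmix_an1 (one_le_of_two_le hLc) hr)) (hmix_an1 (one_le_of_two_le hLc) hr)) (δwOf (one_le_of_two_le hLc) cE cVH cΛ (T2Of_loc (one_le_of_two_le hLc) cE cVH cΛ ((Lc : ℝ) ^ (2 * (3 + 1))) cB Tc (hB_an1 (one_le_of_two_le hLc) hr) (hmix_an1 (one_le_of_two_le hLc) hr)) (hmix_an1 (one_le_of_two_le hLc) hr))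
          (δwOf_pos (one_le_of_two_le hLc) cE cVH cΛ (T2Of_loc (one_le_of_two_le hLc) cE cVH cΛ ((Lc : ℝ) ^ (2 * (3 + 1))) cB Tc (hB_an1 (one_le_of_two_le hLc) hr) (hmix_an1 (one_le_of_two_le hLc) hr)) (hmix_an1 (one_le_of_two_le hLc) hr)) (WbalOf_loc₂ (one_le_of_two_le hLc) cE cVH cΛ (T2Of_loc (one_le_of_two_le hLc) cE cVH cΛ ((Lc : ℝ) ^ (2 * (3 + 1))) cB Tc (hB_an1 (one_le_of_two_le hLc) hr) (hmix_an1 (one_le_of_two_le hLc) hr)) (hmix_an1 (one_le_of_two_le hLc) hr)) j).S))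
      (limTabOf fun j => unitW (sfStep Lc j) (smStep 3 Lc j) (WbalOf 3 Lc cE cVH cΛ (T2Of 3 Lc cE cVH cΛ ((Lc : ℝ) ^ (2 * (3 + 1))) cB Tc (vh₂SAt (toSite r) Lc) (mixFFAt (toSite r) Lc)) (mixFFAt (toSite r) Lc) j))) μ ν)
    {γc β' : ℝ} (hrem : EverySlope S γc) (hup : BetaUpperH β' γc D.βfun) (hlo : ∀ k, ∀ v ∈ Box γc k, -β' ≤ D.βfun k v)
    (hcont : BetaContH γc D.βfun) (hNE : T4ApexHybrid.HybridNE7Under D (EndpointExistence D.C.toB12)) :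
    ContinuumYM4Torus D ∧ ContinuumYM4TorusE D :=
  continuumYM4_torus_of_endpointExistence_nonvacuous D hD hB
    (endpointExistence_of_closedForm_pos hLc hr cE cVH cΛ cB Tc μ ν D.fwd S hβ hM hrem hup hlo hcont) hNE

end Headline

/-! ## §3 The bridge at the CENTRED root — road BF-x's literal `JsBalAn1Ctr` -/

/-- [folklore] **CONVERGENCE TO THE CLOSED FORM AT THE CENTRED ROOT** (`JsBalAn1Ctr … = JsBalAn1 … (ctrOff_mem_box …)` by `rfl`): every `Lc ≥ 2`, every channel,
hypothesis-free — §1 at `hr := ctrOff_mem_box`. -/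
theorem tendsto_closedForm_pinnedCtr (hLc : 2 ≤ Lc) (cE cVH cΛ cB : ℝ) (Tc : Fin 4 → Fin 4 → Fin 4 → Fin 4 → ℝ) (μ ν : Fin 4) :
    Tendsto (fun j => B12Beta.secondMoment (TbalOf Lc (JsBalAn1Ctr (one_le_of_two_le hLc) cE cVH cΛ ((Lc : ℝ) ^ (2 * (3 + 1))) cB Tc) j) μ ν) atTop
      (𝓝 (B12Beta.secondMoment (hessKer (axDressK Lc (limMKerOf fun j => unitK (sfStep Lc j) (smStep 3 Lc j) (KInvStep (d := 3) Lc j)))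
        (axVertexOfK (limMKerOf fun j => unitK (sfStep Lc j) (smStep 3 Lc j) (KInvStep (d := 3) Lc j)) Lc
          (limStOf fun j => unitS (sfStep Lc j) (smStep 3 Lc j) (JsBal0Of (one_le_of_two_le hLc) cE cVH cΛ (WbalOf 3 Lc cE cVH cΛ (T2Of 3 Lc cE cVH cΛ ((Lc : ℝ) ^ (2 * (3 + 1))) cB Tc (vh₂SAt (toSite (ctrOff (3 + 1) Lc)) Lc) (mixFFAt (toSite (ctrOff (3 + 1) Lc)) Lc)) (mixFFAt (toSite (ctrOff (3 + 1) Lc)) Lc))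
            (CwOf (one_le_of_two_le hLc) cE cVH cΛ (T2Of_loc (one_le_of_two_le hLc) cE cVH cΛ ((Lc : ℝ) ^ (2 * (3 + 1))) cB Tc (hB_an1 (one_le_of_two_le hLc) (ctrOff_mem_box (one_le_of_two_le hLc))) (hmix_an1 (one_le_of_two_le hLc) (ctrOff_mem_box (one_le_of_two_le hLc)))) (hmix_an1 (one_le_of_two_le hLc) (ctrOff_mem_box (one_le_of_two_le hLc)))) (δwOf (one_le_of_two_le hLc) cE cVH cΛ (T2Of_loc (one_le_of_two_le hLc) cE cVH cΛ ((Lc : ℝ) ^ (2 * (3 + 1))) cB Tc (hB_an1 (one_le_of_two_le hLc) (ctrOff_mem_box (one_le_of_two_le hLc))) (hmix_an1 (one_le_of_two_le hLc) (ctrOff_mem_box (one_le_of_two_le hLc)))) (hmix_an1 (one_le_of_two_le hLc) (ctrOff_mem_box (one_le_of_two_le hLc))))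
            (δwOf_pos (one_le_of_two_le hLc) cE cVH cΛ (T2Of_loc (one_le_of_two_le hLc) cE cVH cΛ ((Lc : ℝ) ^ (2 * (3 + 1))) cB Tc (hB_an1 (one_le_of_two_le hLc) (ctrOff_mem_box (one_le_of_two_le hLc))) (hmix_an1 (one_le_of_two_le hLc) (ctrOff_mem_box (one_le_of_two_le hLc)))) (hmix_an1 (one_le_of_two_le hLc) (ctrOff_mem_box (one_le_of_two_le hLc)))) (WbalOf_loc₂ (one_le_of_two_le hLc) cE cVH cΛ (T2Of_loc (one_le_of_two_le hLc) cE cVH cΛ ((Lc : ℝ) ^ (2 * (3 + 1))) cB Tc (hB_an1 (one_le_of_two_le hLc) (ctrOff_mem_box (one_le_of_two_le hLc))) (hmix_an1 (one_le_of_two_le hLc) (ctrOff_mem_box (one_le_of_two_le hLc)))) (hmix_an1 (one_le_of_two_le hLc) (ctrOff_mem_box (one_le_of_two_le hLc)))) j).S))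
        (limTabOf fun j => unitW (sfStep Lc j) (smStep 3 Lc j) (WbalOf 3 Lc cE cVH cΛ (T2Of 3 Lc cE cVH cΛ ((Lc : ℝ) ^ (2 * (3 + 1))) cB Tc (vh₂SAt (toSite (ctrOff (3 + 1) Lc)) Lc) (mixFFAt (toSite (ctrOff (3 + 1) Lc)) Lc)) (mixFFAt (toSite (ctrOff (3 + 1) Lc)) Lc) j))) μ ν)) :=
  tendsto_closedForm_pinned hLc (ctrOff_mem_box (one_le_of_two_le hLc)) cE cVH cΛ cB Tc μ ν

/-- [folklore] **THE BRIDGE AT THE CENTRED ROOT**: `CauchyRate.lim (j ↦ β⁰_j) = M∞` at the centred tables, hypothesis-free — §1 at `hr := ctrOff_mem_box`. -/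
theorem lim_eq_closedForm_pinnedCtr (hLc : 2 ≤ Lc) (cE cVH cΛ cB : ℝ) (Tc : Fin 4 → Fin 4 → Fin 4 → Fin 4 → ℝ) (μ ν : Fin 4) :
    CauchyRate.lim (fun j => B12Beta.secondMoment (TbalOf Lc (JsBalAn1Ctr (one_le_of_two_le hLc) cE cVH cΛ ((Lc : ℝ) ^ (2 * (3 + 1))) cB Tc) j) μ ν) =
      B12Beta.secondMoment (hessKer (axDressK Lc (limMKerOf fun j => unitK (sfStep Lc j) (smStep 3 Lc j) (KInvStep (d := 3) Lc j)))
        (axVertexOfK (limMKerOf fun j => unitK (sfStep Lc j) (smStep 3 Lc j) (KInvStep (d := 3) Lc j)) Lc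
          (limStOf fun j => unitS (sfStep Lc j) (smStep 3 Lc j) (JsBal0Of (one_le_of_two_le hLc) cE cVH cΛ (WbalOf 3 Lc cE cVH cΛ (T2Of 3 Lc cE cVH cΛ ((Lc : ℝ) ^ (2 * (3 + 1))) cB Tc (vh₂SAt (toSite (ctrOff (3 + 1) Lc)) Lc) (mixFFAt (toSite (ctrOff (3 + 1) Lc)) Lc)) (mixFFAt (toSite (ctrOff (3 + 1) Lc)) Lc))
            (CwOf (one_le_of_two_le hLc) cE cVH cΛ (T2Of_loc (one_le_of_two_le hLc) cE cVH cΛ ((Lc : ℝ) ^ (2 * (3 + 1))) cB Tc (hB_an1 (one_le_of_two_le hLc) (ctrOff_mem_box (one_le_of_two_le hLc))) (hmix_an1 (one_le_of_two_le hLc) (ctrOff_mem_box (one_le_of_two_le hLc)))) (hmix_an1 (one_le_of_two_le hLc) (ctrOff_mem_box (one_le_of_two_le hLc)))) (δwOf (one_le_of_two_le hLc) cE cVH cΛ (T2Of_loc (one_le_of_two_le hLc) cE cVH cΛ ((Lc : ℝ) ^ (2 * (3 + 1))) cB Tc (hB_an1 (one_le_of_two_le hLc) (ctrOff_mem_box (one_le_of_two_le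 hLc))) (hmix_an1 (one_le_of_two_le hLc) (ctrOff_mem_box (one_le_of_two_le hLc)))) (hmix_an1 (one_le_of_two_le hLc) (ctrOff_mem_box (one_le_of_two_le hLc))))
            (δwOf_pos (one_le_of_two_le hLc) cE cVH cΛ (T2Of_loc (one_le_of_two_le hLc) cE cVH cΛ ((Lc : ℝ) ^ (2 * (3 + 1))) cB Tc (hB_an1 (one_le_of_two_le hLc) (ctrOff_mem_box (one_le_of_two_le hLc))) (hmix_an1 (one_le_of_two_le hLc) (ctrOff_mem_box (one_le_of_two_le hLc)))) (hmix_an1 (one_le_of_two_le hLc) (ctrOff_mem_box (one_le_of_two_le hLc)))) (WbalOf_loc₂ (one_le_of_two_le hLc) cE cVH cΛ (T2Of_loc (one_le_of_two_le hLc) cE cVH cΛ ((Lc : ℝ) ^ (2 * (3 + 1))) cB Tc (hB_an1 (one_le_of_two_le hLc) (ctrOff_mem_box (one_le_of_two_le hLc))) (hmix_an1 (one_le_of_two_le hLc) (ctrOff_mem_box (one_le_of_two_le hLc)))) (hmix_an1 (one_le_of_two_le hLc) (ctrOff_mem_box (one_le_of_two_le hLc)))) j).S))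
        (limTabOf fun j => unitW (sfStep Lc j) (smStep 3 Lc j) (WbalOf 3 Lc cE cVH cΛ (T2Of 3 Lc cE cVH cΛ ((Lc : ℝ) ^ (2 * (3 + 1))) cB Tc (vh₂SAt (toSite (ctrOff (3 + 1) Lc)) Lc) (mixFFAt (toSite (ctrOff (3 + 1) Lc)) Lc)) (mixFFAt (toSite (ctrOff (3 + 1) Lc)) Lc) j))) μ ν :=
  lim_eq_closedForm_pinned hLc (ctrOff_mem_box (one_le_of_two_le hLc)) cE cVH cΛ cB Tc μ ν

end Summit.QuantumFields.BalabanUV.Gaps.D1PinnedLimitClosedForm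

end
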